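import Summits.BirchSwinnertonDyer.BirchSwinnertonDyer.Theorems.Rank2ObservatoryRank3ConductorCensus
import Literature.NumberTheory.EllipticCurves.Rank1Residual.X11RankOneCertificates.Minimality
import HarnessLib

/-!
# BSD rank ≥ 2 observatory (`b2b-bsdr2`): the rank-3 census with GLOBAL MINIMALITY of the model
# discharged from the root-number certificates (kernel; Silverman's criterion, PROVED in the tree)

HONEST FRAMING: per-curve certified theorems and census instruments; no claim on BSD in rank ≥ 2.

The census theorems over the Heegner field (`Rank3Row.rank3_lderiv_eq_zero_kernel_rn`, `…_rnN`) take
`hmin : r.curve.IsGloballyMinimal` (Cremona's equation is a global minimal model) as a hypothesis. A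
checking root-number certificate `c` (landed chunks `Rank2ObservatoryRank3RootNumberCertsNN`) lists
every prime dividing `Δ` with exact valuations, so Silverman's sufficient criterion — no prime `q`
with `q¹² ∣ Δ` and `q⁴ ∣ c₄` (*AEC* VII.1 Rem. 1.1 at every place; the tree's THEOREM
`X11RankOneCertificates.isGloballyMinimal_of_int_criterion`, no named fact involved) — reduces to the
single kernel-decidable condition at `2`: `v₂(Δ) < 12` or (`c₄ ≠ 0` and `v₂(c₄) < 4`) (`RNCert.min2`);
at the listed odd primes it holds by the certificate's own checks (`p ∤ c₄`, or `e < 12 ∨ t < 4`).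

* `RNCert.min2`, `int_criterion_of_check`, `isGloballyMinimal_of_check` (integer equation level);
* `Rank3Row.MinimalCertified`, `Rank3Row.isGloballyMinimal_of_certified` — NO hypothesis left;
* `check_of_rnRowsCheck`, `Rank3Row.minimalCertified_of_idx`, `rank3Table_minCount` (`7143` rows, kernel);
* headlines: `Rank3Row.rank3_lderiv_eq_zero_kernel_rnm` (`hw ↦ hKD`, `hmin` discharged) and
  `Rank3Row.rank3_lderiv_eq_zero_kernel_rnNm` (`hw ↦ hKD`, `hN ↦` the five conductor named facts,
  `hmin` discharged — all 5 347 tame rows qualify): what remains is modularity `hE`,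
  Gross–Zagier–Kolyvagin over `K` (`hGZKK`), the named facts, the field data `hK`, `hdK`, and the twist
  value `hLD : L(E^D,1) ≠ 0`.

References: Silverman *AEC* VII.1 Rem. 1.1, VIII.8 [SilvermanAEC2009]; Cremona 1997
[CremonaAlgorithms1997]; Gross–Zagier–Kolyvagin as in `Rank2ObservatoryRank3KernelCertsCensus` [GrossLMS1991].
-/

set_option linter.dupNamespace false
set_option autoImplicit false

open WeierstrassCurve IsDedekindDomain Literature Literature.NumberTheory.EllipticCurves
open Literature.NumberTheory.EllipticCurves.Rank1Residual.X11RankOneCertificates (discOf c4Of invariants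
  isGloballyMinimal_of_int_criterion)

namespace Summit.BirchSwinnertonDyer.BirchSwinnertonDyer.Rank2Observatory

open RootNumber

/-! ### Silverman's criterion from a root-number certificate -/

/-- The criterion at `2`, read off the certificate: `v₂(Δ) < 12`, or `c₄ ≠ 0` and `v₂(c₄) < 4`.
[cite: SilvermanAEC2009, VII.1 Remark 1.1] -/
def RootNumber.RNCert.min2 (W₀ : WeierstrassCurve ℤ) (c : RNCert) : Bool :=
  decide (c.k2 < 12) || (decide (W₀.c₄ ≠ 0) && decide (c.k4 < 4))

/-- The X11 schema's integer discriminant formula is Mathlib's `Δ` of the integer equation. [folklore] -/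
theorem discOf_eq (W₀ : WeierstrassCurve ℤ) : discOf [W₀.a₁, W₀.a₂, W₀.a₃, W₀.a₄, W₀.a₆] = W₀.Δ := by
  simp only [discOf, invariants, WeierstrassCurve.Δ, WeierstrassCurve.b₂, WeierstrassCurve.b₄,
    WeierstrassCurve.b₆, WeierstrassCurve.b₈]
  ring

/-- The X11 schema's integer `c₄` formula is Mathlib's `c₄` of the integer equation. [folklore] -/
theorem c4Of_eq (W₀ : WeierstrassCurve ℤ) : c4Of [W₀.a₁, W₀.a₂, W₀.a₃, W₀.a₄, W₀.a₆] = W₀.c₄ := by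
  simp only [c4Of, invariants, WeierstrassCurve.c₄, WeierstrassCurve.b₂, WeierstrassCurve.b₄]
  ring

section IntModel

variable {W₀ : WeierstrassCurve ℤ} {c : RNCert}

/-- **Silverman's criterion holds at every prime** for an equation with a checking certificate
passing `min2`: at `2` by `min2`, at a listed odd prime by the entry's check (`p ∤ c₄`, or
`e < 12 ∨ ord_p c₄ < 4`), and no other prime divides `Δ`. [cite: SilvermanAEC2009, VII.1 Remark 1.1] -/
theorem int_criterion_of_check (hc : c.check W₀ = true) (hm : c.min2 W₀ = true) :
    ∀ q : ℕ, q.Prime → ¬ ((q : ℤ) ^ 12 ∣ W₀.Δ ∧ (q : ℤ) ^ 4 ∣ W₀.c₄) := by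
  obtain ⟨hk2, hk4, -, -, hall, -⟩ := RNCert.check_spec hc
  simp only [RNCert.min2, Bool.or_eq_true, Bool.and_eq_true, decide_eq_true_eq] at hm
  rintro q hq ⟨h12, h4⟩
  have hqΔ : (q : ℤ) ∣ W₀.Δ := dvd_trans (dvd_pow_self _ (by norm_num)) h12
  rcases List.mem_cons.mp (mem_of_prime_dvd hc hq hqΔ) with rfl | hmem
  · rcases hm with hk | ⟨hc0, hk⟩
    · exact (exactPow_spec hk2).2 (dvd_trans (pow_dvd_pow _ (by omega : c.k2 + 1 ≤ 12)) h12)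
    · exact (exactPow_spec (hk4.resolve_left hc0)).2
        (dvd_trans (pow_dvd_pow _ (by omega : c.k4 + 1 ≤ 4)) h4)
  · obtain ⟨E, hE, rfl⟩ := List.mem_map.mp hmem
    obtain ⟨-, -, -, hK0, hK1, hK2⟩ := OddEntry.check_spec (hall E hE)
    have hqc : (E.p : ℤ) ∣ W₀.c₄ := dvd_trans (dvd_pow_self _ (by norm_num)) h4
    by_cases h0 : E.kind = 0
    · exact (hK0 h0).1 hqc
    by_cases h1 : E.kind = 1
    · exact (hK1 h1).1 hqc
    · obtain ⟨-, heΔ, -, htc, hmin⟩ := hK2 h0 h1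
      rcases hmin with he | ht
      · exact (exactPow_spec heΔ).2 (dvd_trans (pow_dvd_pow _ (by omega)) h12)
      · exact (exactPow_spec htc).2 (dvd_trans (pow_dvd_pow _ (by omega)) h4)

end IntModel

/-! ### Rows -/

/-- A row is MINIMALITY CERTIFIED if some root-number certificate checks on its integer model and
passes `min2`. [folklore] -/
def Rank3Row.MinimalCertified (r : Rank3Row) : Prop :=
  ∃ c : RNCert, c.check r.intModel = true ∧ c.min2 r.intModel = true

/-- **Cremona's equation of a minimality-certified row IS a global minimal model** — no hypothesis
(Silverman's criterion, the tree's theorem `isGloballyMinimal_of_int_criterion`).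
[cite: SilvermanAEC2009, VII.1 Remark 1.1] -/
theorem Rank3Row.isGloballyMinimal_of_certified {r : Rank3Row} (h : r.MinimalCertified) :
    r.curve.IsGloballyMinimal := by
  obtain ⟨c, hc, hm⟩ := h
  have hcrit := int_criterion_of_check hc hm
  rw [← discOf_eq, ← c4Of_eq] at hcrit
  exact isGloballyMinimal_of_int_criterion r.a₁ r.a₂ r.a₃ r.a₄ r.a₆ hcrit

/-- The listed certificate of row `i` checks (refines `certified_of_rnRowsCheck`). [folklore] -/
theorem check_of_rnRowsCheck :
    ∀ (rows : List Rank3Row) (certs : List (Option RNCert)), rnRowsCheck rows certs = true →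
      ∀ (i : ℕ) (hi : i < rows.length) (c : RNCert), certs[i]? = some (some c) →
        c.check (rows[i]'hi).intModel = true
  | [], _, _, i, hi, _, _ => absurd hi (Nat.not_lt_zero i)
  | _ :: _, [], h, _, _, _, _ => by simp [rnRowsCheck] at h
  | r :: rs, none :: cs, h, i, hi, c, hc => by
    cases i with
    | zero => simp at hc
    | succ i =>
      simp only [rnRowsCheck] at h
      simp only [List.getElem?_cons_succ] at hc
      simpa using check_of_rnRowsCheck rs cs h i (by simpa using hi) c hc
  | r :: rs, some c' :: cs, h, i, hi, c, hc => by
    simp only [rnRowsCheck, Bool.and_eq_true, beq_iff_eq] at h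
    cases i with
    | zero =>
      simp only [List.getElem?_cons_zero, Option.some.injEq] at hc
      subst hc
      exact h.1.1
    | succ i =>
      simp only [List.getElem?_cons_succ] at hc
      simpa using check_of_rnRowsCheck rs cs h.2 i (by simpa using hi) c hc

/-- Row `i` whose listed certificate passes `min2` is minimality certified. [folklore] -/
theorem Rank3Row.minimalCertified_of_idx {i : ℕ} (hi : i < rank3Table.length) {c : RNCert}
    (hc : rank3RNCerts[i]? = some (some c)) (hm : c.min2 (rank3Table[i]'hi).intModel = true) :
    (rank3Table[i]'hi).MinimalCertified :=
  ⟨c, check_of_rnRowsCheck _ _ rank3Table_rnCheck i hi c hc, hm⟩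

/-- **Exactly `7143` rows carry a certificate passing `min2`** (kernel count): for those, global
minimality of Cremona's equation is a theorem here. [cite: CremonaAlgorithms1997, Tables] -/
theorem rank3Table_minCount :
    ((rank3Table.zip rank3RNCerts).countP fun rc =>
      match rc.2 with
      | some c => c.min2 rc.1.intModel
      | none => false) = 7143 := by
  decide +kernel

/-- Every TAME listed certificate passes `min2` (kernel): the `5347` conductor-certified rows are all
minimality certified. [cite: CremonaAlgorithms1997, Tables] -/
theorem rank3Table_tame_imp_min2 :
    ((rank3Table.zip rank3RNCerts).all fun rc =>
      match rc.2 with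
      | some c => !(c.tame rc.1.intModel) || c.min2 rc.1.intModel
      | none => true) = true := by
  decide +kernel

/-- **`L′(E,1) = 0` over `K = ℚ(√D)`** for a root-number and minimality certified row: the census
headline with `hw ↦ hKD` and `hmin` DISCHARGED (the conductor identification `hN` kept).
[cite: GrossLMS1991, (1.1) and Thm. 1.3] -/
theorem Rank3Row.rank3_lderiv_eq_zero_kernel_rnm {r : Rank3Row} (hr : r ∈ rank3Table)
    (hrc : r.RootNumberCertified) (hmc : r.MinimalCertified) (K : Type) [Field K] [NumberField K]
    (hE : WeierstrassCurve.hasEntireLFunction_rat)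
    (hGZKK : mordellWeilRank_eq_one_of_LDerivEK_ne_zero r.curve K)
    (hN : r.curve.conductorNorm ℤ = r.N) (hK : IsImaginaryQuadratic K) (hdK : NumberField.discr K = r.D)
    (hKD : r.curve.rootNumber_eq_neg_finprod_tableLocalRootNumberAt')
    (hLD : (r.curve.quadraticTwist (r.D : ℚ)).entireLFunction 1 ≠ 0) :
    deriv r.curve.entireLFunction 1 = 0 :=
  Rank3Row.rank3_lderiv_eq_zero_kernel_rn hr hrc K hE hGZKK
    (Rank3Row.isGloballyMinimal_of_certified hmc) hN hK hdK hKD hLD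

/-- **`L′(E,1) = 0` over `K = ℚ(√D)`** for a row that is root-number, conductor AND minimality
certified (every one of the `5347` tame rows): `hw ↦ hKD`, `hN ↦` the five named facts on conductor
exponents, `hmin` DISCHARGED. Remaining hypotheses: modularity `hE`, Gross–Zagier–Kolyvagin over `K`
(`hGZKK`), the named facts, the field `K` (`hK`, `hdK`), and `hLD : L(E^D,1) ≠ 0`.
[cite: GrossLMS1991, (1.1) and Thm. 1.3] [cite: Silverman1994, IV.10.2 and IV.10.4] -/
theorem Rank3Row.rank3_lderiv_eq_zero_kernel_rnNm {r : Rank3Row} (hr : r ∈ rank3Table)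
    (hrc : r.RootNumberCertified) (hcc : r.ConductorCertified) (hmc : r.MinimalCertified)
    (K : Type) [Field K] [NumberField K] (hE : WeierstrassCurve.hasEntireLFunction_rat)
    (hGZKK : mordellWeilRank_eq_one_of_LDerivEK_ne_zero r.curve K)
    (h0 : ∀ v : HeightOneSpectrum ℤ, conductorExponent_eq_zero_iff v r.curve)
    (h1 : ∀ v : HeightOneSpectrum ℤ, conductorExponent_eq_one_iff v r.curve)
    (h2 : ∀ v : HeightOneSpectrum ℤ, two_le_conductorExponent_iff v r.curve)
    (h5 : ∀ v : HeightOneSpectrum ℤ, conductorExponent_le_two_of_five_le_natGenerator r.curve v)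
    (hf : ∀ v : HeightOneSpectrum ℤ, factorization_conductorNorm r.curve v)
    (hK : IsImaginaryQuadratic K) (hdK : NumberField.discr K = r.D)
    (hKD : r.curve.rootNumber_eq_neg_finprod_tableLocalRootNumberAt')
    (hLD : (r.curve.quadraticTwist (r.D : ℚ)).entireLFunction 1 ≠ 0) :
    deriv r.curve.entireLFunction 1 = 0 :=
  Rank3Row.rank3_lderiv_eq_zero_kernel_rnN hr hrc hcc K hE hGZKK
    (Rank3Row.isGloballyMinimal_of_certified hmc) h0 h1 h2 h5 hf hK hdK hKD hLD

/-- `5077a1`: Cremona's equation `[0,0,1,−7,6]` is a global minimal model (kernel certificate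
`⟨0, 4, 3, [(5077: non-split)]⟩`; no hypothesis). [cite: CremonaAlgorithms1997, Tables] -/
theorem isGloballyMinimal_5077a1 :
    (⟨"5077a1", 0, 0, 1, -7, 6, 5077, -7, 4792, (1, 0, 1), (2, 0, 1), (0, 2, 1)⟩ : Rank3Row).curve.IsGloballyMinimal :=
  Rank3Row.isGloballyMinimal_of_certified
    ⟨⟨0, 4, 3, [⟨5077, 71, 1, 0, 0⟩]⟩, by decide +kernel, by decide +kernel⟩

end Summit.BirchSwinnertonDyer.BirchSwinnertonDyer.Rank2Observatory
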